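import Summits.QuantumFields.YangMills.Theses.ToronSmallBall
import Summits.QuantumFields.YangMills.Theorems.SwapTwistDeficitSmallBallDoor
import Summits.QuantumFields.YangMills.Theorems.ToronSmallBallAssembly
import HarnessLib

/-!
# `ToronSmallBall.Assembly2` (AssemblyDeep) — the deep-cap pair feeds the same small-ball door (D-0145 LINE g12-A rev 1)

Items ⟨stmt-QuantumFields-23956⟩ `ToronCoreRaritySubQuartic` (cap `2/5`, weaker than ⟨23898⟩) and ⟨23957⟩
`OffCoreStripWindowDeep` (every cap `≤ 2/5`, stronger than ⟨23899⟩) replace the cap-`3/10` pair in the route's `closes`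
after the registered instrument (kit j321877/j321999/j322003: the cap-`3/10` core mass does not shrink for `β ≤ 256`,
the cap-`2/5` one decays like `β^{-(0.15…0.3)}`; planner memo `PLAN-X1-translates.md`: below the quartic scale
`β^{-1/4}` core rarity falls to disjoint sheet-translates).  The assembly proof of ⟨23900⟩ (p683812, prover ym-dw-p1) is
cap-generic; this file re-runs it verbatim for the deep pair and records the cap monotonicities.  No summit is proved.
-/

open MeasureTheory Filter Topology Real Function
open scoped Matrix ComplexConjugate BigOperators
open Literature.MathematicalPhysics.QuantumLattice
open Literature.MathematicalPhysics.QuantumFieldTheory hiding SU2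
open Summit.QuantumFields.YangMills.Theorems

namespace Summit.QuantumFields.YangMills.Theorems.ToronSmallBall

open Summit.QuantumFields.YangMills.Theorems.FemtoTransferGap
open Summit.QuantumFields.YangMills.Theorems.FemtoTransferGap.FlatSheet
open Summit.QuantumFields.YangMills.Theses.ToronSmallBall

/-- ⟨23898⟩ ⇒ ⟨23956⟩ (cap monotonicity `3/10 ≤ 2/5`). -/
theorem toronCoreRaritySubQuartic_of_coreRarity (h : ToronCoreRarity) : ToronCoreRaritySubQuartic := by
  obtain ⟨γc, h1, rest⟩ := h
  exact ⟨γc, by linarith, rest⟩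

/-- ⟨23957⟩ ⇒ ⟨23899⟩ (cap monotonicity). -/
theorem offCoreStripWindow_of_deep (h : OffCoreStripWindowDeep) : OffCoreStripWindow := by
  intro γc hγc; exact h γc (by linarith)

set_option maxHeartbeats 800000 in
/-- ★ **`ToronSmallBall.Assembly2` (item name AssemblyDeep) holds** (item ⟨stmt-QuantumFields-23958⟩): the proof of `assembly_proof` with the cap
`3/10` replaced by `2/5` — union bound `STRIP ⊆ CORE ∪ (STRIP ∩ OFF-CORE)`, exponents `a = min(a₀,a₁)/2`, door
`SwapTwistDeficit.twistDeficitLaplaceWindow_of_smallBall`. [cite: MontvayMunster1994, (3.145)] [cite: Luscher1983, §2] -/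
theorem assemblyDeep_proof : Summit.QuantumFields.YangMills.Theses.ToronSmallBall.Assembly2 := by
  intro hX1 hX2
  obtain ⟨γc, hγc, a₁, ha₁, β₁, L₁, h1⟩ := hX1
  obtain ⟨a₀, ha₀, ha₀1, h2⟩ := hX2 γc hγc
  set a' : ℝ := min a₀ a₁ with ha'
  have ha'0 : 0 < a' := lt_min ha₀ ha₁
  have ha'₀ : a' ≤ a₀ := min_le_left _ _
  have ha'₁ : a' ≤ a₁ := min_le_right _ _
  obtain ⟨γ, hγ, β₂, L₂, h2'⟩ := h2 a' ha'0 ha'₀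
  have hγ' : γ < 1 / 2 - 3 * (a' / 2) := by linarith
  refine SwapTwistDeficit.twistDeficitLaplaceWindow_of_smallBall (a := a' / 2) (γ := γ) (by positivity) (by linarith) hγ'
    ⟨max (max β₁ β₂) (max 1 ((16 : ℝ) ^ (2 / a'))), max L₁ L₂, fun β hβ L _ hL hLβ => ?_⟩
  have hββ₁ : β₁ ≤ β := ((le_max_left _ _).trans (le_max_left _ _)).trans hβ
  have hββ₂ : β₂ ≤ β := ((le_max_right _ _).trans (le_max_left _ _)).trans hβ
  have hβ1 : 1 ≤ β := ((le_max_left _ _).trans (le_max_right _ _)).trans hβ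
  have hβ16 : (16 : ℝ) ^ (2 / a') ≤ β := ((le_max_right _ _).trans (le_max_right _ _)).trans hβ
  have hβ0 : 0 < β := by linarith
  have hL₁ : L₁ ≤ L := (le_max_left _ _).trans hL
  have hL₂ : L₂ ≤ L := (le_max_right _ _).trans hL
  have hL1 : 1 ≤ L := NeZero.one_le
  -- the windows nest
  have hLβ₁ : (L : ℝ) ≤ β ^ a₁ := hLβ.trans (Real.rpow_le_rpow_of_exponent_le hβ1 (by linarith))
  have hLβ' : (L : ℝ) ≤ β ^ a' := hLβ.trans (Real.rpow_le_rpow_of_exponent_le hβ1 (by linarith))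
  have hcore := h1 β hββ₁ L hL₁ hLβ₁
  have hoff := h2' β hββ₂ L hL₂ hLβ'
  set S := configPerm (G := FemtoTransferGap.SU2) (L := L) (Equiv.swap (0 : Fin 3) 1) with hS
  set Z : ℝ := TT.physTrace L β (2 * L) with hZ
  have hZpos : 0 < Z := TT.physTrace_two_mul_pos hL1 hβ1
  -- the three events
  set CORE : Set (GaugeConfig 3 L FemtoTransferGap.SU2) := {U | polDist U ≤ β ^ (-γc)} with hCORE
  set OFF : Set (GaugeConfig 3 L FemtoTransferGap.SU2) := {U | |polDist U - polDist (S U)| ≤ β ^ (-γ) ∧ β ^ (-γc) < polDist U} with hOFF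
  set STRIP : Set (GaugeConfig 3 L FemtoTransferGap.SU2) := {U | |polDist U - polDist (S U)| ≤ β ^ (-γ)} with hSTRIP
  have hCOREm : MeasurableSet CORE := measurableSet_le isPhys_polDist.measurable measurable_const
  have hOFFm : MeasurableSet OFF :=
    (measurableSet_strip _).inter (measurableSet_lt measurable_const isPhys_polDist.measurable)
  have hSTRIPm : MeasurableSet STRIP := measurableSet_strip _
  have hsub : STRIP ⊆ CORE ∪ OFF := fun U hU => by
    by_cases hc : polDist U ≤ β ^ (-γc)
    · exact Or.inl hc
    · exact Or.inr ⟨hU, not_le.1 hc⟩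
  have hstrip : TT.insTrace L β (STRIP.indicator fun _ => (1 : ℝ)) 0 ≤ (β ^ (-a₁) + β ^ (-a')) * Z := by
    calc TT.insTrace L β (STRIP.indicator fun _ => (1 : ℝ)) 0 ≤ TT.insTrace L β ((CORE ∪ OFF).indicator fun _ => (1 : ℝ)) 0 :=
          TT.insTrace_indicator_zero_mono hβ0.le hSTRIPm (hCOREm.union hOFFm) hsub
      _ ≤ TT.insTrace L β (CORE.indicator fun _ => (1 : ℝ)) 0 + TT.insTrace L β (OFF.indicator fun _ => (1 : ℝ)) 0 :=
          TT.insTrace_indicator_zero_union_le hβ0.le hCOREm hOFFm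
      _ ≤ β ^ (-a₁) * Z + β ^ (-a') * Z := add_le_add hcore hoff
      _ = (β ^ (-a₁) + β ^ (-a')) * Z := by ring
  -- exponents: `β^{-a₁} + β^{-a'} ≤ 2β^{-a'} ≤ β^{-a'/2}/8`
  have hmono : β ^ (-a₁) ≤ β ^ (-a') := Real.rpow_le_rpow_of_exponent_le hβ1 (by linarith)
  have h16 : (16 : ℝ) ≤ β ^ (a' / 2) := by
    have h := Real.rpow_le_rpow (by positivity) hβ16 (by positivity : (0 : ℝ) ≤ a' / 2)
    rwa [← Real.rpow_mul (by norm_num), show 2 / a' * (a' / 2) = 1 by field_simp, Real.rpow_one] at h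
  have hkey : β ^ (-a₁) + β ^ (-a') ≤ β ^ (-(a' / 2)) / 8 := by
    have e1 : β ^ (-a') = β ^ (-(a' / 2)) * (β ^ (a' / 2))⁻¹ := by
      rw [← Real.rpow_neg hβ0.le, ← Real.rpow_add hβ0]; congr 1; ring
    have hpos : 0 < β ^ (-(a' / 2)) := Real.rpow_pos_of_pos hβ0 _
    have hinv : (β ^ (a' / 2))⁻¹ ≤ 1 / 16 := by
      rw [inv_eq_one_div]; exact div_le_div_of_nonneg_left zero_le_one (by norm_num) h16
    calc β ^ (-a₁) + β ^ (-a') ≤ 2 * β ^ (-a') := by linarith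
      _ = 2 * (β ^ (-(a' / 2)) * (β ^ (a' / 2))⁻¹) := by rw [e1]
      _ ≤ 2 * (β ^ (-(a' / 2)) * (1 / 16)) := by
          refine mul_le_mul_of_nonneg_left (mul_le_mul_of_nonneg_left hinv hpos.le) (by norm_num)
      _ = β ^ (-(a' / 2)) / 8 := by ring
  calc TT.insTrace L β (STRIP.indicator fun _ => (1 : ℝ)) 0 ≤ (β ^ (-a₁) + β ^ (-a')) * Z := hstrip
    _ ≤ β ^ (-(a' / 2)) / 8 * Z := mul_le_mul_of_nonneg_right hkey hZpos.le


end Summit.QuantumFields.YangMills.Theorems.ToronSmallBall
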